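import Literature.AnabelianGeometry.SemiGraphs.BTempQDPairHomHatWC
import HarnessLib

/-!
# Semi-graphs of anabelioids, Appendix, proof of Theorem A.4: `Hom^` for ARBITRARY QD-pairs of
# `B^temp(Π)` and its bijection with `Hom_T(B/Γ_B, C/Γ_C)`

Mochizuki, *Semi-graphs of anabelioids*, Publ. RIMS **42** (2006) 221–322, Appendix, proof of
Theorem A.4, manuscript pp. 84–85 (PRIMS p. 314 l. 9 – p. 315 l. 2)
[cite: MochizukiSemiAnbd2006, Thm A.4 proof pp.84-85]: after reconstructing `Hom_{T_i}(B/Γ_B, C/Γ_C)`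
as `Hom^((B, Γ_B), (C, Γ_C))` for STRONGLY connected pairs, the text passes to weakly connected
pairs through the strongly connected pairs `(B′, Γ_B′)` of the connected components `B′ ⊆ B` ("the
subset of collections of elements that correspond via these bijections … the natural projections
of this direct product determine bijections … `⥲ Hom_{T_i}(q_i((B, Γ_B)), q_i((C, Γ_C)))`") and then:
"Finally, as observed above, since `T_i` is an almost totally epimorphic category of countably
connected type, the definition of `Hom^`, as well as the resulting bijection of `Hom^` with
`Hom_{T_i}` and the natural map from `Hom` to `Hom^`, **extend immediately to pairs of objects of
`D_i` that are not necessarily weakly connected**."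

Row **A4-lim-gen** of `plan/L3/SUBDAG-SemiAnbd-Cor311.md` (seat abc-iut-w4-d089): that last
extension, for the model temperoid `T = B^temp(Π)`, in ONE step and with the TARGET LEFT
UNDECOMPOSED — which is what makes it immediate: for `(B′, Γ_B′)` strongly connected and `(C, Γ_C)`
ARBITRARY the comparison `Hom^((B′, Γ_B′), (C, Γ_C)) → Hom_T(B′/Γ_B′, C/Γ_C)` is already a
bijection (`homHatToHom_injective`, abc-iut-w4-d081; `homHatToHom_surjective`, abc-iut-w5-d129,
`Π` tempered), and the classes `[b] ∈ B/Γ_B` are swept by the components `B′_b = Π·b`: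

* **`QDPair.HomHatGen P C`** — for ANY QD-pairs `P = (B, Γ_B)`, `C = (C, Γ_C)`: the families
  `(y_b)_{b ∈ B}`, `y_b ∈ Hom^((B′_b, Γ_{B′_b}), (C, Γ_C))` over the component pairs
  (`QDPair.componentPair`, abc-iut-w4-d048, whose `BTempQDPairHomHatWC.lean` is the printed
  double-indexed weakly connected case) that MATCH under every `γ_B ∈ Γ_B` carrying `B′_b` onto
  `B′_{b′}` (`QDPair.componentIso`, transported by `QDPair.HomHat.map`) — the single-indexed form of
  the printed "collections of elements that correspond via these bijections";
* `HomHatGen.valAt`, **`HomHatGen.toHom : HomHatGen P C → (B/Γ_B ⟶ C/Γ_C)`** — glue the arrows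
  `B′_b/Γ → C/Γ_C` along the (jointly surjective) family `q(B′_b → B)`; well defined by the matching
  (`valAt_aut`) and equivariant (`valAt_ρ`); characterised by `orbitQuotientMap_incl_toHom :
  q(B′_b → B) ≫ toHom y = homHatToHom (y_b)`;
* **`HomHatGen.ofHom : (P ⟶ C) → HomHatGen P C`** — "the natural map from `Hom` to `Hom^`" for
  arbitrary pairs (restrict `f` to each component), with `toHom_ofHom : toHom (ofHom f) = q(f)`.

The bijectivity of `toHom` (all pairs, `Π` tempered) and of the projections `y ↦ y_b` (weakly
connected source) are in the proof companion `BTempQDPairHomHatGenProofs.lean`.  Elementary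
`Π`-set bookkeeping; nothing refers to the IUT corpus; no side is taken on any disputed claim.
-/

open CategoryTheory

namespace Literature.AnabelianGeometry.SemiGraphs

open Literature.AlgebraicGeometry.Frobenioids (IsConnectedObj)
open Literature.AlgebraicGeometry.Frobenioids.QuasiTemperoid.BTempConnected (hom_ρ hom_ext_apply
  ρ_one_apply ρ_mul_apply ρ_inv_apply)

universe u

variable {G : Type u} [Group G] [TopologicalSpace G]

namespace QDPair

/-! ### `Hom^` for arbitrary pairs: matching families over the components of the source -/

/-- **`Hom^((B, Γ_B), (C, Γ_C))` for ARBITRARY QD-pairs of `B^temp(Π)`**: families `(y_b)_{b ∈ B}`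
with `y_b ∈ Hom^((B′_b, Γ_{B′_b}), (C, Γ_C))` (`B′_b = Π·b` the component through `b` with
`Γ_{B′_b}` = the stabiliser of `[B′_b]` in `Γ_B`, restricted) which "correspond via these bijections":
`γ_B ∈ Γ_B` with `γ_B(B′_b) = B′_{b′}` transports `y_b` to `y_{b′}`.  (Components are indexed by
their points; for `b, b′` on one component the matching along `γ_B = 1` identifies the two copies.)
[cite: MochizukiSemiAnbd2006, Thm A.4 proof pp.84-85] -/
def HomHatGen (P C : QDPair (BTemp G)) : Type (u + 1) :=
  { y : ∀ b : P.A.obj.V, HomHat (P.componentPair b) C //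
    ∀ ⦃b b' : P.A.obj.V⦄ (γ : Aut P.A) (hγ : γ ∈ P.Γ)
      (h : ∃ a : G, P.A.obj.ρ a b' = (γ.hom.hom.hom b : P.A.obj.V)),
      HomHat.map (componentIso γ h hγ) (𝟙 C) (y b) = y b' }

namespace HomHatGen

variable {P C : QDPair (BTemp G)}

/-- The component `y_b` of a matching family ("the natural projections of this direct product").
[cite: MochizukiSemiAnbd2006, Thm A.4 proof p.84] -/
def proj (y : HomHatGen P C) (b : P.A.obj.V) : HomHat (P.componentPair b) C := y.1 b

/-- The matching condition of a family. [cite: MochizukiSemiAnbd2006, Thm A.4 proof p.84] -/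
theorem map_proj (y : HomHatGen P C) {b b' : P.A.obj.V} (γ : Aut P.A) (hγ : γ ∈ P.Γ)
    (h : ∃ a : G, P.A.obj.ρ a b' = (γ.hom.hom.hom b : P.A.obj.V)) :
    HomHat.map (componentIso γ h hγ) (𝟙 C) (y.proj b) = y.proj b' :=
  y.2 γ hγ h

/-- Matching families are determined by their components. [cite: MochizukiSemiAnbd2006, Thm A.4 proof p.84] -/
@[ext] theorem ext {y y' : HomHatGen P C} (h : ∀ b, y.proj b = y'.proj b) : y = y' :=
  Subtype.ext (funext h)

/-- A point of the component `B′_b` is related to `b` by `γ_B = 1`: `a⁻¹ · z = b`.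
[cite: MochizukiSemiAnbd2006, Thm A.4 proof p.84] -/
theorem exists_ρ_eq_one_apply_base (b : P.A.obj.V) (z : (BTemp.orbitObj P.A b).obj.V) :
    ∃ a : G, P.A.obj.ρ a z.1 = ((1 : Aut P.A).hom.hom.hom b : P.A.obj.V) := by
  obtain ⟨a, ha⟩ := z.2
  exact ⟨a⁻¹, by rw [← ha, ρ_inv_apply]; rfl⟩

/-- `γ_B(b)` lies on the component of `γ_B(b)` (`a = 1`). [cite: MochizukiSemiAnbd2006, Thm A.4 proof p.84] -/
theorem exists_ρ_eq_aut_apply_base (γ : Aut P.A) (b : P.A.obj.V) :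
    ∃ a : G, P.A.obj.ρ a (γ.hom.hom.hom b) = (γ.hom.hom.hom b : P.A.obj.V) :=
  ⟨1, ρ_one_apply P.A _⟩

/-! ### The natural map `Hom → Hom^` for arbitrary pairs -/

/-- Restricting a morphism of QD-pairs `f : (B, Γ_B) → (C, Γ_C)` to the component `B′_b` and moving
`b` by `γ_B ∈ Γ_B` changes the class in `Hom̄((B′_b, Γ), (C, Γ_C))` only through `Γ_C`
(`γ_B ≫ f = f ≫ γ_C`). [cite: MochizukiSemiAnbd2006, Thm A.4 proof p.84] -/
theorem homBarMk_incl_autOfMem_comp {b : P.A.obj.V} {γ : Aut P.A} (hγ : γ ∈ P.Γ) (f : P ⟶ C) :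
    homBarMk (P.componentIncl b ≫ (autOfMem P γ hγ).hom ≫ f) = homBarMk (P.componentIncl b ≫ f) := by
  obtain ⟨γ', hγ', h⟩ := f.comm γ hγ
  rw [homBarMk_eq_iff]
  refine ⟨γ'⁻¹, C.Γ.inv_mem hγ', ?_⟩
  change (P.componentIncl b).hom ≫ f.hom = ((P.componentIncl b).hom ≫ γ.hom ≫ f.hom) ≫ γ'.inv
  rw [← h]
  simp only [Category.assoc, Iso.hom_inv_id, Category.comp_id]

/-- **"The natural map from `Hom` to `Hom^`" for arbitrary pairs**: `f ↦ (f|_{B′_b})_b`, each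
`f|_{B′_b} = (B′_b → B) ≫ f` placed on the identity cover of the strongly connected `(B′_b, Γ_{B′_b})`.
[cite: MochizukiSemiAnbd2006, Thm A.4 proof pp.84-85] -/
def ofHom (f : P ⟶ C) : HomHatGen P C :=
  ⟨fun b => homHatOfHom (P.componentPair_isStronglyConnected b) (P.componentIncl b ≫ f), by
    intro b b' γ hγ h
    show HomHat.map _ (𝟙 C) (homHatOfHom _ (P.componentIncl b ≫ f)) =
      homHatOfHom _ (P.componentIncl b' ≫ f)
    unfold homHatOfHom
    rw [HomHat.map_mk, HomBar.postcomp_mk, Category.comp_id]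
    -- the transition `e.hom : (B′_b, 𝟙 ≫ e) → (B′_{b′}, 𝟙)` between the two identity covers
    let t : OneProperCover.Transition
        ((OneProperCover.self _ (P.componentPair_isStronglyConnected b)).transport
          (componentIso γ h hγ))
        (OneProperCover.self _ (P.componentPair_isStronglyConnected b')) :=
      { hom := (componentIso γ h hγ).hom
        w := by
          change (componentIso γ h hγ).hom ≫ (Iso.refl _).hom =
            (Iso.refl _).hom ≫ (componentIso γ h hγ).hom
          rw [Iso.refl_hom, Iso.refl_hom, Category.id_comp, Category.comp_id]
        isOneProper := isOneProper_iso (componentIso γ h hγ) }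
    rw [← homHatMk_precomp t, HomBar.precomp_mk]
    congr 1
    change homBarMk (P.componentIncl b ≫ f) =
      homBarMk ((componentIso γ h hγ).hom ≫ P.componentIncl b' ≫ f)
    rw [componentIso_hom, ← Category.assoc, componentHom_comp_incl, Category.assoc,
      homBarMk_incl_autOfMem_comp hγ f]⟩

/-- `ofHom f` at `b` is the class of `f|_{B′_b}` on the identity cover.
[cite: MochizukiSemiAnbd2006, Thm A.4 proof pp.84-85] -/
theorem proj_ofHom (f : P ⟶ C) (b : P.A.obj.V) :
    (ofHom f).proj b = homHatOfHom (P.componentPair_isStronglyConnected b) (P.componentIncl b ≫ f) :=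
  rfl

/-! ### Values and the glued arrow -/

variable [IsTopologicalGroup G]

/-- The comparison map after transport along an isomorphism of the source (target fixed):
`homHatToHom (map e 𝟙 x) = q(e⁻¹) ≫ homHatToHom x`. [cite: MochizukiSemiAnbd2006, Thm A.4 proof p.84] -/
theorem homHatToHom_map_id {P P' : QDPair (BTemp G)} (e : P ≅ P') (x : HomHat P C) :
    homHatToHom P' C (HomHat.map e (𝟙 C) x) = orbitQuotientMap e.inv ≫ homHatToHom P C x := by
  rw [homHatToHom_map, inv_orbitQuotientMap_iso]
  have h1 : orbitQuotientMap (𝟙 C) = 𝟙 C.orbitQuotient := (orbitQuotientFunctor (G := G)).map_id C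
  rw [h1, Category.comp_id]

/-- **The value of a matching family at a point `x ∈ B`**: the class of the base point of `B′_x` under
the arrow `B′_x/Γ → C/Γ_C` attached to `y_x`. [cite: MochizukiSemiAnbd2006, Thm A.4 proof pp.84-85] -/
noncomputable def valAt (y : HomHatGen P C) (x : P.A.obj.V) : C.orbitQuotient.obj.V :=
  (homHatToHom _ C (y.proj x)).hom.hom ((P.componentPair x).orbitMk (BTemp.orbitPt P.A x))

/-- **Key computation**: on the whole component `B′_b`, the arrow attached to `y_b` computes the
values of the family — `homHatToHom (y_b) [z] = valAt y z` for `z ∈ B′_b` (matching along `γ_B = 1`).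
[cite: MochizukiSemiAnbd2006, Thm A.4 proof pp.84-85] -/
theorem homHatToHom_proj_apply (y : HomHatGen P C) (b : P.A.obj.V)
    (z : (BTemp.orbitObj P.A b).obj.V) :
    ((homHatToHom _ C (y.proj b)).hom.hom ((P.componentPair b).orbitMk z) : C.orbitQuotient.obj.V) =
      y.valAt z.1 := by
  have hm := y.map_proj 1 P.Γ.one_mem (exists_ρ_eq_one_apply_base b z)
  unfold valAt
  rw [← hm, homHatToHom_map_id]
  change ((homHatToHom _ C (y.proj b)).hom.hom
      ((orbitQuotientMap (componentIso 1 (exists_ρ_eq_one_apply_base b z) P.Γ.one_mem).inv).hom.hom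
        ((P.componentPair z.1).orbitMk (BTemp.orbitPt P.A z.1))) : C.orbitQuotient.obj.V) = _
  rw [orbitQuotientMap_apply]
  congr 2

/-- The value is `Γ_B`-invariant: `valAt y (γ_B x) = valAt y x` (matching along `γ_B`).
[cite: MochizukiSemiAnbd2006, Thm A.4 proof pp.84-85] -/
theorem valAt_aut (y : HomHatGen P C) {γ : Aut P.A} (hγ : γ ∈ P.Γ) (x : P.A.obj.V) :
    y.valAt (γ.hom.hom.hom x) = y.valAt x := by
  have hm := y.map_proj γ hγ (exists_ρ_eq_aut_apply_base γ x)
  conv_lhs => unfold valAt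
  rw [← hm, homHatToHom_map_id]
  change ((homHatToHom _ C (y.proj x)).hom.hom
      ((orbitQuotientMap (componentIso γ (exists_ρ_eq_aut_apply_base γ x) hγ).inv).hom.hom
        ((P.componentPair _).orbitMk (BTemp.orbitPt P.A _))) : C.orbitQuotient.obj.V) = _
  rw [orbitQuotientMap_apply]
  have hpt : ((componentIso γ (exists_ρ_eq_aut_apply_base γ x) hγ).inv.hom.hom.hom
      (BTemp.orbitPt P.A (γ.hom.hom.hom x)) : (BTemp.orbitObj P.A x).obj.V) = BTemp.orbitPt P.A x := by
    apply Subtype.ext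
    change ((γ.hom ≫ γ.inv).hom.hom x : P.A.obj.V) = x
    rw [γ.hom_inv_id]
    rfl
  rw [hpt]
  rfl

/-- The value is `Π`-equivariant: `valAt y (a · x) = a · valAt y x`.
[cite: MochizukiSemiAnbd2006, Thm A.4 proof pp.84-85] -/
theorem valAt_ρ (y : HomHatGen P C) (a : G) (x : P.A.obj.V) :
    y.valAt (P.A.obj.ρ a x) = C.orbitQuotient.obj.ρ a (y.valAt x) := by
  have h := y.homHatToHom_proj_apply x ((BTemp.orbitObj P.A x).obj.ρ a (BTemp.orbitPt P.A x))
  change ((homHatToHom _ C (y.proj x)).hom.hom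
      ((P.componentPair x).orbitQuotient.obj.ρ a ((P.componentPair x).orbitMk (BTemp.orbitPt P.A x))) :
        C.orbitQuotient.obj.V) = y.valAt (P.A.obj.ρ a x) at h
  rw [hom_ρ] at h
  exact h.symm

/-- The `Γ_B`-invariant, `Π`-equivariant map `B → C/Γ_C`, `x ↦ valAt y x`, as an arrow of `B^temp(Π)`.
[cite: MochizukiSemiAnbd2006, Thm A.4 proof pp.84-85] -/
noncomputable def arrow (y : HomHatGen P C) : P.A ⟶ C.orbitQuotient :=
  ObjectProperty.homMk
    { hom := TypeCat.ofHom y.valAt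
      comm := fun a => by
        apply ConcreteCategory.hom_ext
        intro x
        exact y.valAt_ρ a x }

/-- `arrow y` on points. [cite: MochizukiSemiAnbd2006, Thm A.4 proof pp.84-85] -/
@[simp] theorem arrow_apply (y : HomHatGen P C) (x : P.A.obj.V) :
    (y.arrow.hom.hom x : C.orbitQuotient.obj.V) = y.valAt x := rfl

/-- `arrow y` is `Γ_B`-invariant. [cite: MochizukiSemiAnbd2006, Thm A.4 proof pp.84-85] -/
theorem aut_comp_arrow (y : HomHatGen P C) : ∀ γ ∈ P.Γ, γ.hom ≫ y.arrow = y.arrow :=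
  fun _ hγ => hom_ext_apply fun x => y.valAt_aut hγ x

/-- **The arrow `B/Γ_B → C/Γ_C` of `T` attached to a matching family** (descend `arrow y` through the
quotient `B → B/Γ_B`): the last map of the printed chain
`Hom^((B, Γ_B), (C, Γ_C)) ⥲ … ⥲ Hom_{T_i}(q_i((B, Γ_B)), q_i((C, Γ_C)))`.
[cite: MochizukiSemiAnbd2006, Thm A.4 proof pp.84-85] -/
noncomputable def toHom (y : HomHatGen P C) : P.orbitQuotient ⟶ C.orbitQuotient :=
  P.orbitQuotientDesc y.arrow y.aut_comp_arrow

/-- `toHom y` on classes: `[x] ↦ valAt y x`. [cite: MochizukiSemiAnbd2006, Thm A.4 proof pp.84-85] -/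
@[simp] theorem toHom_apply (y : HomHatGen P C) (x : P.A.obj.V) :
    ((toHom y).hom.hom (P.orbitMk x) : C.orbitQuotient.obj.V) = y.valAt x := rfl

/-- **`toHom` restricted to a component is the arrow attached to that component**:
`q(B′_b → B) ≫ toHom y = homHatToHom (y_b)`. [cite: MochizukiSemiAnbd2006, Thm A.4 proof pp.84-85] -/
theorem orbitQuotientMap_incl_toHom (y : HomHatGen P C) (b : P.A.obj.V) :
    orbitQuotientMap (P.componentIncl b) ≫ toHom y = homHatToHom _ C (y.proj b) := by
  apply hom_ext_apply
  intro q
  induction q using Quotient.ind with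
  | _ z =>
    change ((toHom y).hom.hom (P.orbitMk z.1) : C.orbitQuotient.obj.V) =
      (homHatToHom _ C (y.proj b)).hom.hom ((P.componentPair b).orbitMk z)
    rw [toHom_apply, homHatToHom_proj_apply]

end HomHatGen

end QDPair

end Literature.AnabelianGeometry.SemiGraphs
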